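import Literature.AlgebraicGeometry.AbelianSchemes.AbelianSchemeRelDimOfConnected
import Literature.AlgebraicGeometry.AbelianSchemes.AbelianSchemeOverFibreDim
import Mathlib.Topology.Connected.PathConnected
import HarnessLib

/-!
# An abelian scheme pulled back to the spectrum of a LOCAL ring has ONE relative dimension `g` — «the source of `g`»
# for the Artinian tower of the (Mc) N3′ line (cell hodgecm-mathlib, brick J11)

Layer `Literature/AlgebraicGeometry/AbelianSchemes`, namespace `Literature.AlgebraicGeometry.AbelianSchemes.AbelianSchemeOver` (and one
generic lemma in `Literature.AlgebraicGeometry.Morphisms`).  THEOREMS ONLY (no `def`, no instance, no notation, no `sorry`).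

THE POINT.  The (Mc) N3′ letters carry `A : AbelianSchemeOver (Spec R)` with NO relative dimension, and `Spec R` may be disconnected, so
there is no global `g`; but every brick of the Kodaira–Spencer count at a point works over the LOCAL Artinian base `Spec C′` (the small
extension), and `Spec C′` is CONNECTED — every point specialises to the closed point — so ★ G6 `AbelianSchemeOver.exists_isOfRelDim`
([MumfordFogartyKirwan1994] Def. 7.2 (i) «of dimension `g`»; [GortzWedhorn2020] Remark 16.54: the relative dimension of a smooth morphism
is locally constant) applies to `A ×_S Spec C′`.  This file packages exactly that:

* `Morphisms.connectedSpace_Spec_of_isLocalRing` — `Spec C` is (path-)connected for a local ring `C` (Mathlib `Specializes.joinedIn` +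
  `IsLocalRing.specializes_closedPoint`);
* `AbelianSchemeOver.exists_isOfRelDim_baseChange_of_isLocalRing` — `∃ g, (A.baseChange c).IsOfRelDim g` for `c : Spec C ⟶ S`, `C` local;
* `AbelianSchemeOver.smoothOfRelativeDimension_fibre_comp_of_isOfRelDim_baseChange`, `…dim_fibre_comp_eq_of_isOfRelDim_baseChange` — the
  fibres of `A` ITSELF over points `Spec Ω → Spec C → S` then have dimension that same `g` (base change along the composite vs. the iterated
  base change: Mathlib `pullbackLeftPullbackSndIso`; uniqueness of the relative dimension ★ `AbelianVarietyProofs.eq_of_smoothOfRelativeDimension`);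
* `AbelianSchemeOver.exists_relDim_package_of_isLocalRing` — THE CONSUMER FORM: ONE `g` with (i) `(A.baseChange c).IsOfRelDim g`,
  (ii) `SmoothOfRelativeDimension g (A.baseChange c).X.hom`, (iii) every field-valued fibre of `A.baseChange c` has dimension `g`
  (★ `dim_fibre_of_isOfRelDim`), (iv) every fibre of `A` over a point through `c` has dimension `g`.  Instantiate at `A := A.baseChange p`
  (`S := S′`), `c := c′ : Spec C′ ⟶ S′` for the letters' `A″ = (A.baseChange p).baseChange c′`.

Cell hodgecm-mathlib (D-0151 ∕ FLOOR 0), P1 (Mc) N3′ J11 (lead B-p02 (g17), planner F0P1c-plan (g0)); PROOF lane, count-neutral.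
HC_CM is proved only modulo the 7 printed citations until rung 0 closes; nothing here is about HC.

## References
* [MumfordFogartyKirwan1994] D. Mumford, J. Fogarty, F. Kirwan, *Geometric Invariant Theory*, 3rd ed. (1994), Ch. 7 §2 Definition 7.2 (p. 129).
* [GortzWedhorn2020] U. Görtz, T. Wedhorn, *Algebraic Geometry I*, 2nd ed. (2020), Remark 16.54 (p. 539); Section (4.7) (pp. 107–108).
* [StacksProject] The Stacks Project, Tag 04MF (connected components of spectra), Tag 00EC (the spectrum of a local ring).
-/

noncomputable section

universe u

open CategoryTheory CategoryTheory.Limits AlgebraicGeometry Topology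

namespace Literature.AlgebraicGeometry.Morphisms

/-- **The spectrum of a local ring is connected** — indeed path-connected: every point specialises to the closed point
(Mathlib `IsLocalRing.specializes_closedPoint`), and a specialisation is a path (Mathlib `Specializes.joinedIn`).
[cite: StacksProject, Tag 00EC] [cite: StacksProject, Tag 04MF] -/
theorem connectedSpace_Spec_of_isLocalRing (C : Type u) [CommRing C] [IsLocalRing C] : ConnectedSpace ↥(Spec (.of C)) := by
  have h : IsPathConnected (Set.univ : Set (PrimeSpectrum C)) :=
    ⟨IsLocalRing.closedPoint C, Set.mem_univ _, fun y _ =>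
      ((IsLocalRing.specializes_closedPoint y).joinedIn (Set.mem_univ y) (Set.mem_univ _)).symm⟩
  exact connectedSpace_iff_univ.mpr h.isConnected

end Literature.AlgebraicGeometry.Morphisms

namespace Literature.AlgebraicGeometry.AbelianSchemes

namespace AbelianSchemeOver

variable {S : Scheme.{u}} (A : AbelianSchemeOver S) {C : Type u} [CommRing C] [IsLocalRing C] (c : Spec (.of C) ⟶ S)

/-- **An abelian scheme pulled back to the spectrum of a LOCAL ring has a relative dimension**: `∃ g, (A ×_S Spec C).IsOfRelDim g`
(★ `exists_isOfRelDim` over the connected base `Spec C`). [cite: MumfordFogartyKirwan1994, Ch. 7 §2 Definition 7.2 (p. 129)]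
[cite: GortzWedhorn2020, Remark 16.54 (p. 539)] -/
theorem exists_isOfRelDim_baseChange_of_isLocalRing : ∃ g : ℕ, (A.baseChange c).IsOfRelDim g :=
  haveI := Morphisms.connectedSpace_Spec_of_isLocalRing C
  (A.baseChange c).exists_isOfRelDim

variable {A c}

omit [IsLocalRing C] in
/-- **The fibre of `A` over a point THROUGH `c` is smooth of relative dimension `g`** when `A ×_S Spec C` is of relative dimension `g`:
`A ×_S Spec Ω` (along `s ≫ c`) is the base change of `A ×_S Spec C` along `s` (Mathlib `pullbackLeftPullbackSndIso`), and the relative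
dimension is stable under base change and isomorphisms. [cite: GortzWedhorn2020, Section (4.7) (pp. 107–108) and Remark 16.54 (p. 539)] -/
theorem smoothOfRelativeDimension_fibre_comp_of_isOfRelDim_baseChange {g : ℕ} (h : (A.baseChange c).IsOfRelDim g)
    {Ω : Type u} [Field Ω] (s : Spec (.of Ω) ⟶ Spec (.of C)) :
    SmoothOfRelativeDimension g (A.fibre (s ≫ c)).X.hom := by
  have h₁ : SmoothOfRelativeDimension g ((A.baseChange c).fibre s).X.hom := h.fibre s
  -- `(A.fibre (s ≫ c)).X.hom = pullback.snd A.X.hom (s ≫ c)` and `((A.baseChange c).fibre s).X.hom = pullback.snd (pullback.snd A.X.hom c) s`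
  change SmoothOfRelativeDimension g (pullback.snd (pullback.snd A.X.hom c) s) at h₁
  change SmoothOfRelativeDimension g (pullback.snd A.X.hom (s ≫ c))
  have e : (pullbackLeftPullbackSndIso A.X.hom c s).hom ≫ pullback.snd A.X.hom (s ≫ c) =
      pullback.snd (pullback.snd A.X.hom c) s :=
    pullbackLeftPullbackSndIso_hom_snd A.X.hom c s
  rw [← e] at h₁
  exact (MorphismProperty.cancel_left_of_respectsIso (@SmoothOfRelativeDimension g) _ _).mp h₁

omit [IsLocalRing C] in
/-- **Hence the fibre of `A` over a point through `c` has dimension `g`** (uniqueness of the relative dimension of a smooth morphism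
with non-empty source, ★ `AbelianVarietyProofs.eq_of_smoothOfRelativeDimension`, against ★ `AbelianScheme.isOfRelDim_dim`).
[cite: GortzWedhorn2020, Remark 16.54 (p. 539)] -/
theorem dim_fibre_comp_eq_of_isOfRelDim_baseChange {g : ℕ} (h : (A.baseChange c).IsOfRelDim g)
    {Ω : Type u} [Field Ω] (s : Spec (.of Ω) ⟶ Spec (.of C)) :
    (A.fibre (s ≫ c)).toAbelianVariety.dim = g := by
  have h₁ := smoothOfRelativeDimension_fibre_comp_of_isOfRelDim_baseChange h s
  have h₂ : SmoothOfRelativeDimension (A.fibre (s ≫ c)).toAbelianVariety.dim (A.fibre (s ≫ c)).X.hom :=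
    (A.fibre (s ≫ c)).isOfRelDim_dim
  haveI : Nonempty (A.fibre (s ≫ c)).X.left := ⟨Motives.AbelianVariety.origin (A.fibre (s ≫ c)).toAbelianVariety⟩
  exact Motives.AbelianVarietyProofs.eq_of_smoothOfRelativeDimension _ h₂ h₁

variable (A c)

/-- **THE SOURCE OF `g` (consumer form).**  For an abelian scheme `A → S` and a LOCAL ring `C` with `c : Spec C → S` there is ONE `g`
such that: (i) `A ×_S Spec C` is of relative dimension `g`; (ii) its structure morphism is `SmoothOfRelativeDimension g` (the same
fact, Mathlib's predicate — the input of the infinitesimal-point panels over `R₀ := C`); (iii) every field-valued fibre of `A ×_S Spec C`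
is an abelian variety of dimension `g` (★ `dim_fibre_of_isOfRelDim` — the input of the `H¹(𝒪)`- and Lie-dimension counts); (iv) every
fibre of `A` itself over a point `Spec Ω → Spec C → S` has dimension `g`.  For the (Mc) N3′ letters take `A := A.baseChange p` over `S′`
and `c := c′ : Spec C′ ⟶ S′`. [cite: MumfordFogartyKirwan1994, Ch. 7 §2 Definition 7.2 (p. 129)] [cite: GortzWedhorn2020, Remark 16.54 (p. 539)] -/
theorem exists_relDim_package_of_isLocalRing :
    ∃ g : ℕ, (A.baseChange c).IsOfRelDim g ∧ SmoothOfRelativeDimension g (A.baseChange c).X.hom ∧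
      (∀ ⦃Ω : Type u⦄ [Field Ω] (s : Spec (.of Ω) ⟶ Spec (.of C)), ((A.baseChange c).fibre s).toAbelianVariety.dim = g) ∧
      ∀ ⦃Ω : Type u⦄ [Field Ω] (s : Spec (.of Ω) ⟶ Spec (.of C)), (A.fibre (s ≫ c)).toAbelianVariety.dim = g := by
  obtain ⟨g, hg⟩ := A.exists_isOfRelDim_baseChange_of_isLocalRing c
  exact ⟨g, hg, hg, fun Ω _ s => dim_fibre_of_isOfRelDim hg s, fun Ω _ s => dim_fibre_comp_eq_of_isOfRelDim_baseChange hg s⟩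

end AbelianSchemeOver

end Literature.AlgebraicGeometry.AbelianSchemes

end
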